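import Literature.Geometry.Lorentzian.KerrStarCoord
import Literature.Geometry.Lorentzian.KerrEnergyIdentity
import HarnessLib

/-!
# The Kerr wave operator in the coordinates `(t*, r, θ, φ*)`: Kerr–Schild time and Kerr's
# ingoing spheroidal coordinates

(family `gr`; namespace `Literature.Geometry.Lorentzian.Kerr`; written from the proving seat of
`Literature.Barriers.FinalStateConjecture.Aretakis2012_pointwiseDecay` — Aretakis, JFA 263 (2012),
Thm. 5 — whose printed proof (§15 with §5.3) commutes the wave equation with the Carter operator
`Q`, i.e. uses the separated form `ρ² □_g = [radial part] + Q` of the Kerr wave operator in the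
coordinates `(v, r, θ, φ*)`; this file supplies that operator in coordinates for the prelude's Kerr
metric.)

The tree's Kerr metric is `g = η + 2H ℓ ⊗ ℓ` in ingoing Kerr–Schild Cartesian coordinates on
`E4 = ℝ⁴` (`KerrSchild.lean`), and its wave operator has the coordinate expression
`□_g Φ = ∑ g^{μν} ∂_μ∂_νΦ + ∑ c^ν ∂_νΦ`, `g^{μν} = η^{μν} − 2Hℓ^μℓ^ν`, `c^ν = ∑_μ ∂_μ g^{μν} = −(2M/Σ)ℓ^ν`
(`Kerr.dalembertian_eq_divergence`, `Kerr.inverseMetric_apply`, `Kerr.divInverseMetric_eq`).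
`KerrStarCoord.lean` introduced Kerr's ingoing spheroidal coordinates on the leaves,
`Y_a(r, θ, φ) = ((r cos φ − a sin φ) sin θ, (r sin φ + a cos φ) sin θ, r cos θ)` (`Kerr.kerrStar`), and
computed the flat Laplacian in them. Here we prove:

* `Kerr.starChart a : E4 → E4`, `κ(t*, r, θ, φ) = (t*, Y_a(r, θ, φ))` (the coordinate quadruple
  stored as a vector `q`, `q 0 = t*, q 1 = r, q 2 = θ, q 3 = φ`), smooth (`contDiff_starChart`); its
  coordinate frame `Kerr.starFrame a q i = Dκ(q)∂_i` (`fderiv_starChart_basisVector`,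
  `hasDerivAt_starChart_line`): `κ_*∂_{t*} = ∂₀`, `κ_*∂_r = (0, n̂)`, `κ_*∂_θ = (0, rθ̂ + a cos θ φ̂)`,
  `κ_*∂_φ = (0, sin θ (rφ̂ + a∂_φφ̂))`; the geometry along the chart: `r ∘ κ = r`
  (`radius_starChart`), `Σ ∘ κ = r² + a² cos² θ` (`blSigma_starChart`), `H ∘ κ = Mr/Σ`
  (`scalarH_starChart`) and **`ℓ♯ ∘ κ = κ_*(∂_r − ∂_{t*})`** (`nullVector_starChart`: the Kerr–Schild
  null vector is `∂_r` of the system `(v, r, θ, φ*)`, `v = t* + r`, Aretakis's `Y`);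
* the chain rules for the pull-back `F = Φ ∘ κ` (`Kerr.starPull`): `∂_iF = DΦ(κ_*∂_i)`
  (`fderiv_starPull`) and the second derivatives along the pairs of coordinate lines entering the
  wave operator, with the derivatives of the frame (`fderiv_fderiv_comp_starChart`,
  `fderiv_fderiv_starPull`);
* `Kerr.sum_inverseMetric_mul_bilinForm`, `Kerr.sum_divInverseMetric_mul`: the contractions
  `∑ g^{μν}B(∂_μ,∂_ν) = −B(∂₀,∂₀) + ∑_i B(∂_i,∂_i) − 2H B(ℓ♯,ℓ♯)`, `∑ c^ν L(∂_ν) = −(2M/Σ) L(ℓ♯)`;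
* `Kerr.spatial_trace_spheroidal`: the flat spatial trace in the spheroidal frame,
  `Σ ∑_{i=1}^3 B(∂_i,∂_i) = (r²+a²)B(ñ,ñ) + B(Θ̃,Θ̃) + B(P̃,P̃) + a sin θ (B(ñ,P̃) + B(P̃,ñ))`
  (`Kerr.frame_bilinear_identity` + `Kerr.sph_frame_trace`, transported to `E4`);
* `Kerr.blSigma_mul_coordWave_frame` (**frame form, all `θ`**): at `x = κ(q)`, `r > 0`, for every
  bilinear `B` and linear `L`,
  `Σ (∑ g^{μν}(x)B(∂_μ,∂_ν) + ∑ c^ν(x)L(∂_ν)) = −Σ B(∂₀,∂₀) + (r²+a²)B(ñ,ñ) + B(Θ̃,Θ̃) + B(P̃,P̃)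
   + a sin θ (B(ñ,P̃)+B(P̃,ñ)) − 2Mr B(ℓ♯,ℓ♯) − 2M L(ℓ♯)`;
* `Kerr.blSigma_mul_coordWave_starChart` (**coordinate form, `sin θ ≠ 0`**): for `Φ` of class `C²`
  at `x = κ(q)`,
  `Σ (∑ g^{μν}∂_μ∂_νΦ + ∑ c^ν∂_νΦ)(x) = −Σ ∂₀∂₀F + (r²+a²)∂₁∂₁F + 2r∂₁F + ∂₂∂₂F + cot θ ∂₂F
   + (sin θ)⁻²∂₃∂₃F + 2a∂₁∂₃F − 2Mr(∂₁∂₁F − 2∂₁∂₀F + ∂₀∂₀F) − 2M(∂₁F − ∂₀F)`,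
  i.e., with `T = ∂₀`, `Y = ∂₁ − ∂₀`, `Φ_* = ∂₃`: `ρ²□_g = Δ YY + 2(r²+a²)TY + 2aY∂_φ + Δ'Y + 2rT
   + ∂_θ² + cot θ∂_θ + (sin θ)⁻²∂_φ² + a²sin²θ TT + 2aT∂_φ` — the operator `ρ²□_g` of Aretakis 2012,
  §2.4 in the system `(v, r, θ, φ*)`, here derived from the Kerr–Schild form (its restriction to the
  extremal horizon `r = M = a` is `horizon_density_deriv_identity` of
  `ExtremalHorizonChargeConservationProofs.lean`; its `M = 0` case is `Kerr.laplacian_kerrStar`).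

Everything is coordinate calculus on `E4` (no `[Kerr.Facts]`); the link with the prelude's abstract
`dalembertian` is `Kerr.dalembertian_eq_divergence` /
`dalembertian_eq_hessian_add_firstOrder` (`ExtremalHorizonChargeConservationProofs.lean`).

## References

* S. Aretakis, *Decay of axisymmetric solutions of the wave equation on extreme Kerr backgrounds*,
  J. Funct. Anal. 263 (2012) 2770–2831 (arXiv:1110.2006), §2.4 (the systems `(v, r, θ, φ*)`,
  `(t*, r)`; `T = ∂_v`, `Y = ∂_r`, `Φ = ∂_{φ*}`), §5.3 (the Carter operator) (key `Aretakis2012`).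
* M. Visser, *The Kerr spacetime: a brief introduction*, arXiv:0706.0622, (33)–(35) and §4 (Kerr's
  coordinates `x + iy = (r + ia) e^{iφ} sin θ`, `z = r cos θ`) (key `arXiv07060622`).
* R. P. Kerr, A. Schild, 1965, §2 (`g = η + 2Hℓ⊗ℓ`, `det g = −1`) (key `KerrSchild1965`).
* Y. Shlapentokh-Rothman, Comm. Math. Phys. 329 (2014), §1.2.1 (`ρ² = r² + a² cos² θ`)
  (key `ShlapentokhRothman2014KleinGordon`).
-/

noncomputable section

open Real Set Filter
open scoped Topology

namespace Literature.Geometry.Lorentzian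

namespace Kerr

/-! ### The Kerr-star chart map and its coordinate frame -/

/-- **The Kerr-star chart map** `κ_a : ℝ⁴ → ℝ⁴`, `κ_a(t*, r, θ, φ) = (t*, Y_a(r, θ, φ))`
(`Kerr.kerrStar`): ingoing Kerr–Schild time `t*` and Kerr's ingoing spheroidal coordinates on the
leaves. The coordinate quadruple is stored as a vector `q ∈ E4` (`q 0 = t*`, `q 1 = r`, `q 2 = θ`,
`q 3 = φ`). Visser arXiv:0706.0622, §4; Aretakis, JFA 263 (2012), §2.4 (the systems `(v, r, θ, φ*)`
and `(t*, r, θ, φ*)`). [cite: arXiv07060622, §4] -/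
def starChart (a : ℝ) (q : E4) : E4 :=
  E4.ofTimeSpace (q 0) (kerrStar a (q 1) (q 2) (q 3))

/-- Components of the chart map. [cite: arXiv07060622, §4] -/
theorem starChart_eq_toLp (a : ℝ) (q : E4) :
    starChart a q = WithLp.toLp 2 ![q 0, (q 1 * cos (q 3) - a * sin (q 3)) * sin (q 2),
      (q 1 * sin (q 3) + a * cos (q 3)) * sin (q 2), q 1 * cos (q 2)] := by
  ext i
  fin_cases i
  · rfl
  · show starChart a q (Fin.succ 0) = _
    rw [starChart, E4.ofTimeSpace_apply_succ, kerrStar_apply_zero]; rfl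
  · show starChart a q (Fin.succ 1) = _
    rw [starChart, E4.ofTimeSpace_apply_succ, kerrStar_apply_one]; rfl
  · show starChart a q (Fin.succ 2) = _
    rw [starChart, E4.ofTimeSpace_apply_succ, kerrStar_apply_two]; rfl

/-- **The coordinate frame of the Kerr-star chart**: `κ_* ∂_{t*} = ∂₀`, `κ_* ∂_r = (0, n̂)`,
`κ_* ∂_θ = (0, r θ̂ + a cos θ φ̂)`, `κ_* ∂_φ = (0, sin θ (r φ̂ + a ∂_φφ̂))` at the coordinate point `q`
(`Kerr.hasDerivAt_kerrStar_r/theta/phi`). [cite: arXiv07060622, §4] -/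
def starFrame (a : ℝ) (q : E4) : Fin 4 → E4
  | 0 => E4.basisVector 0
  | 1 => E4.spaceEmbed (sphRadial (q 2) (q 3))
  | 2 => E4.spaceEmbed (q 1 • sphPolar (q 2) (q 3) + (a * cos (q 2)) • sphAzimuth (q 3))
  | 3 => E4.spaceEmbed (sin (q 2) • (q 1 • sphAzimuth (q 3) + a • sphHoriz (q 3)))

/-- `κ_*∂_{t*} = ∂₀`. [folklore] -/
@[simp] theorem starFrame_zero (a : ℝ) (q : E4) : starFrame a q 0 = E4.basisVector 0 := rfl

/-- `κ_*∂_r = (0, n̂)`. [folklore] -/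
@[simp] theorem starFrame_one (a : ℝ) (q : E4) :
    starFrame a q 1 = E4.spaceEmbed (sphRadial (q 2) (q 3)) := rfl

/-- `κ_*∂_θ = (0, rθ̂ + a cos θ φ̂)`. [folklore] -/
@[simp] theorem starFrame_two (a : ℝ) (q : E4) :
    starFrame a q 2 = E4.spaceEmbed (q 1 • sphPolar (q 2) (q 3) + (a * cos (q 2)) • sphAzimuth (q 3)) :=
  rfl

/-- `κ_*∂_φ = (0, sin θ (rφ̂ + a∂_φφ̂))`. [folklore] -/
@[simp] theorem starFrame_three (a : ℝ) (q : E4) :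
    starFrame a q 3 = E4.spaceEmbed (sin (q 2) • (q 1 • sphAzimuth (q 3) + a • sphHoriz (q 3))) := rfl

/-- The chart map is smooth. [folklore] -/
theorem contDiff_starChart (a : ℝ) {n : WithTop ℕ∞} : ContDiff ℝ n (starChart a) := by
  have h : starChart a = fun q ↦ (WithLp.toLp 2 ![q 0, (q 1 * cos (q 3) - a * sin (q 3)) * sin (q 2),
      (q 1 * sin (q 3) + a * cos (q 3)) * sin (q 2), q 1 * cos (q 2)] : E4) :=
    funext fun q ↦ starChart_eq_toLp a q
  rw [h, contDiff_euclidean]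
  have hc : ∀ j : Fin 4, ContDiff ℝ n fun q : E4 ↦ q j := fun j ↦ contDiff_coord j
  intro i
  fin_cases i
  · simpa using hc 0
  · exact (((hc 1).mul (contDiff_cos.comp (hc 3))).sub
      (contDiff_const.mul (contDiff_sin.comp (hc 3)))).mul (contDiff_sin.comp (hc 2))
  · exact (((hc 1).mul (contDiff_sin.comp (hc 3))).add
      (contDiff_const.mul (contDiff_cos.comp (hc 3)))).mul (contDiff_sin.comp (hc 2))
  · exact (hc 1).mul (contDiff_cos.comp (hc 2))

/-- The `t*`-lines of the chart: `κ(q + s ∂₀) = κ(q) + s ∂₀`, velocity `∂₀`. [cite: arXiv07060622, §4] -/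
theorem hasDerivAt_starChart_line_zero (a : ℝ) (q : E4) :
    HasDerivAt (fun s : ℝ ↦ starChart a (q + s • E4.basisVector 0)) (starFrame a q 0) 0 := by
  have hfun : (fun s : ℝ ↦ starChart a (q + s • E4.basisVector 0)) =
      fun s ↦ (q 0 + s) • E4.basisVector 0 + E4.spaceEmbed (kerrStar a (q 1) (q 2) (q 3)) := by
    funext s
    simp only [starChart, add_smul_basisVector_apply, if_true, show (1 : Fin 4) ≠ 0 by decide,
      show (2 : Fin 4) ≠ 0 by decide, show (3 : Fin 4) ≠ 0 by decide, if_false, add_zero]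
    exact E4.ofTimeSpace_eq_smul_add' _ _
  rw [hfun, starFrame_zero]
  simpa using (((hasDerivAt_id (0 : ℝ)).const_add (q 0)).smul_const (E4.basisVector 0)).add_const
    (E4.spaceEmbed (kerrStar a (q 1) (q 2) (q 3)))

/-- The `r`-lines of the chart have velocity `(0, n̂)`. [cite: arXiv07060622, §4] -/
theorem hasDerivAt_starChart_line_one (a : ℝ) (q : E4) :
    HasDerivAt (fun s : ℝ ↦ starChart a (q + s • E4.basisVector 1)) (starFrame a q 1) 0 := by
  have hfun : (fun s : ℝ ↦ starChart a (q + s • E4.basisVector 1)) =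
      fun s ↦ (q 0) • E4.basisVector 0 + E4.spaceEmbed (kerrStar a (q 1 + s) (q 2) (q 3)) := by
    funext s
    simp only [starChart, add_smul_basisVector_apply, if_true, show (0 : Fin 4) ≠ 1 by decide,
      show (2 : Fin 4) ≠ 1 by decide, show (3 : Fin 4) ≠ 1 by decide, if_false, add_zero]
    exact E4.ofTimeSpace_eq_smul_add' _ _
  rw [hfun, starFrame_one]
  have hin : HasDerivAt (fun s : ℝ ↦ kerrStar a (q 1 + s) (q 2) (q 3)) (sphRadial (q 2) (q 3)) 0 := by
    have h := HasDerivAt.comp_const_add (q 1) 0 (hasDerivAt_kerrStar_r a (q 1 + 0) (q 2) (q 3))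
    simpa using h
  have h := (E4.spaceEmbed.hasFDerivAt.comp_hasDerivAt (0 : ℝ) hin).const_add
    ((q 0) • E4.basisVector 0)
  simpa using h

/-- The `θ`-lines of the chart have velocity `(0, r θ̂ + a cos θ φ̂)`. [cite: arXiv07060622, §4] -/
theorem hasDerivAt_starChart_line_two (a : ℝ) (q : E4) :
    HasDerivAt (fun s : ℝ ↦ starChart a (q + s • E4.basisVector 2)) (starFrame a q 2) 0 := by
  have hfun : (fun s : ℝ ↦ starChart a (q + s • E4.basisVector 2)) =
      fun s ↦ (q 0) • E4.basisVector 0 + E4.spaceEmbed (kerrStar a (q 1) (q 2 + s) (q 3)) := by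
    funext s
    simp only [starChart, add_smul_basisVector_apply, if_true, show (0 : Fin 4) ≠ 2 by decide,
      show (1 : Fin 4) ≠ 2 by decide, show (3 : Fin 4) ≠ 2 by decide, if_false, add_zero]
    exact E4.ofTimeSpace_eq_smul_add' _ _
  rw [hfun, starFrame_two]
  have hin : HasDerivAt (fun s : ℝ ↦ kerrStar a (q 1) (q 2 + s) (q 3))
      (q 1 • sphPolar (q 2) (q 3) + (a * cos (q 2)) • sphAzimuth (q 3)) 0 := by
    have h := HasDerivAt.comp_const_add (q 2) 0 (hasDerivAt_kerrStar_theta a (q 1) (q 2 + 0) (q 3))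
    simpa using h
  have h := (E4.spaceEmbed.hasFDerivAt.comp_hasDerivAt (0 : ℝ) hin).const_add
    ((q 0) • E4.basisVector 0)
  simpa using h

/-- The `φ`-lines of the chart have velocity `(0, sin θ (r φ̂ + a ∂_φφ̂))`. [cite: arXiv07060622, §4] -/
theorem hasDerivAt_starChart_line_three (a : ℝ) (q : E4) :
    HasDerivAt (fun s : ℝ ↦ starChart a (q + s • E4.basisVector 3)) (starFrame a q 3) 0 := by
  have hfun : (fun s : ℝ ↦ starChart a (q + s • E4.basisVector 3)) =
      fun s ↦ (q 0) • E4.basisVector 0 + E4.spaceEmbed (kerrStar a (q 1) (q 2) (q 3 + s)) := by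
    funext s
    simp only [starChart, add_smul_basisVector_apply, if_true, show (0 : Fin 4) ≠ 3 by decide,
      show (1 : Fin 4) ≠ 3 by decide, show (2 : Fin 4) ≠ 3 by decide, if_false, add_zero]
    exact E4.ofTimeSpace_eq_smul_add' _ _
  rw [hfun, starFrame_three]
  have hin : HasDerivAt (fun s : ℝ ↦ kerrStar a (q 1) (q 2) (q 3 + s))
      (sin (q 2) • (q 1 • sphAzimuth (q 3) + a • sphHoriz (q 3))) 0 := by
    have h := HasDerivAt.comp_const_add (q 3) 0 (hasDerivAt_kerrStar_phi a (q 1) (q 2) (q 3 + 0))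
    simpa using h
  have h := (E4.spaceEmbed.hasFDerivAt.comp_hasDerivAt (0 : ℝ) hin).const_add
    ((q 0) • E4.basisVector 0)
  simpa using h

/-- **The coordinate lines of the chart and their tangents**: `s ↦ κ(q + s ∂_i)` has velocity
`starFrame a q i` at `s = 0`. [cite: arXiv07060622, §4] -/
theorem hasDerivAt_starChart_line (a : ℝ) (q : E4) (i : Fin 4) :
    HasDerivAt (fun s : ℝ ↦ starChart a (q + s • E4.basisVector i)) (starFrame a q i) 0 := by
  fin_cases i
  · exact hasDerivAt_starChart_line_zero a q
  · exact hasDerivAt_starChart_line_one a q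
  · exact hasDerivAt_starChart_line_two a q
  · exact hasDerivAt_starChart_line_three a q

/-- **The differential of the chart map on the coordinate basis**: `Dκ(q) ∂_i = starFrame a q i`.
[cite: arXiv07060622, §4] -/
theorem fderiv_starChart_basisVector (a : ℝ) (q : E4) (i : Fin 4) :
    fderiv ℝ (starChart a) q (E4.basisVector i) = starFrame a q i := by
  have hd : DifferentiableAt ℝ (starChart a) q := (contDiff_starChart a).differentiable one_ne_zero q
  have hline : HasDerivAt (fun s : ℝ ↦ starChart a (q + s • E4.basisVector i))
      (fderiv ℝ (starChart a) q (E4.basisVector i)) 0 := by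
    have h := hd.hasFDerivAt.comp_hasDerivAt_of_eq (0 : ℝ)
      (((hasDerivAt_id (0 : ℝ)).smul_const (E4.basisVector i)).const_add q) (by simp)
    simp only [id, one_smul] at h
    exact h
  exact hline.unique (hasDerivAt_starChart_line a q i)

/-! ### Chain rules along the chart: first and second coordinate derivatives of `Φ ∘ κ` -/

section ChainRule

variable {a : ℝ} {Φ : E4 → ℝ} {q : E4}

/-- **First derivatives**: `∂_i (Φ ∘ κ)(q) = DΦ(κ q)(starFrame a q i)`. [folklore] -/
theorem fderiv_comp_starChart (hΦ : DifferentiableAt ℝ Φ (starChart a q)) (i : Fin 4) :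
    fderiv ℝ (fun q' ↦ Φ (starChart a q')) q (E4.basisVector i) =
      fderiv ℝ Φ (starChart a q) (starFrame a q i) := by
  have hd : DifferentiableAt ℝ (starChart a) q := (contDiff_starChart a).differentiable one_ne_zero q
  rw [show (fun q' ↦ Φ (starChart a q')) = Φ ∘ starChart a from rfl, fderiv_comp q hΦ hd,
    ContinuousLinearMap.comp_apply, fderiv_starChart_basisVector]

/-- `Φ ∘ κ` is `C^n` at `q` when `Φ` is `C^n` at `κ q`. [folklore] -/
theorem contDiffAt_comp_starChart {n : WithTop ℕ∞} (hΦ : ContDiffAt ℝ n Φ (starChart a q)) :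
    ContDiffAt ℝ n (fun q' ↦ Φ (starChart a q')) q :=
  hΦ.comp q (contDiff_starChart a).contDiffAt

/-- **Second derivatives along two coordinate lines.** If `Φ` is `C²` at `κ q` and the frame vector
`starFrame a · j` has derivative `w` along the `i`-th coordinate line through `q`, then
`∂_i∂_j (Φ ∘ κ)(q) = D²Φ(κ q)(starFrame a q i, starFrame a q j) + DΦ(κ q)(w)`. [folklore] -/
theorem fderiv_fderiv_comp_starChart (hΦ : ContDiffAt ℝ 2 Φ (starChart a q)) (i j : Fin 4) {w : E4}
    (hw : HasDerivAt (fun s : ℝ ↦ starFrame a (q + s • E4.basisVector i) j) w 0) :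
    fderiv ℝ (fderiv ℝ (fun q' ↦ Φ (starChart a q'))) q (E4.basisVector i) (E4.basisVector j) =
      fderiv ℝ (fderiv ℝ Φ) (starChart a q) (starFrame a q i) (starFrame a q j) +
        fderiv ℝ Φ (starChart a q) w := by
  set F : E4 → ℝ := fun q' ↦ Φ (starChart a q') with hF
  have hF2 : ContDiffAt ℝ 2 F q := contDiffAt_comp_starChart hΦ
  -- `D²F(q)(e_i, e_j) = ∂_i [q' ↦ DF(q') e_j](q)`
  have hFB : HasFDerivAt (fderiv ℝ F) (fderiv ℝ (fderiv ℝ F) q) q :=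
    ((hF2.fderiv_right (m := 1) le_rfl).differentiableAt one_ne_zero).hasFDerivAt
  have h1 : fderiv ℝ (fderiv ℝ F) q (E4.basisVector i) (E4.basisVector j) =
      fderiv ℝ (fun q' ↦ fderiv ℝ F q' (E4.basisVector j)) q (E4.basisVector i) := by
    have h' : HasFDerivAt (fun q' ↦ fderiv ℝ F q' (E4.basisVector j))
        ((fderiv ℝ (fderiv ℝ F) q).flip (E4.basisVector j)) q := by
      simpa using hFB.clm_apply (hasFDerivAt_const (E4.basisVector j) q)
    rw [h'.fderiv, ContinuousLinearMap.flip_apply]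
  rw [h1]
  -- near `q`, `DF(q') e_j = DΦ(κ q')(starFrame a q' j)`
  have hev : ∀ᶠ q' in 𝓝 q, ContDiffAt ℝ 2 Φ (starChart a q') :=
    (contDiff_starChart a (n := 0)).continuous.continuousAt.eventually (hΦ.eventually (by simp))
  have heq : (fun q' ↦ fderiv ℝ F q' (E4.basisVector j)) =ᶠ[𝓝 q]
      fun q' ↦ fderiv ℝ Φ (starChart a q') (starFrame a q' j) := by
    filter_upwards [hev] with q' hq'
    exact fderiv_comp_starChart (hq'.differentiableAt two_ne_zero) j
  rw [heq.fderiv_eq]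
  -- differentiate along the line `s ↦ q + s e_i`
  have hΦB : HasFDerivAt (fderiv ℝ Φ) (fderiv ℝ (fderiv ℝ Φ) (starChart a q)) (starChart a q) :=
    ((hΦ.fderiv_right (m := 1) le_rfl).differentiableAt one_ne_zero).hasFDerivAt
  have hcurve := hasDerivAt_starChart_line a q i
  have hc : HasDerivAt (fun s : ℝ ↦ fderiv ℝ Φ (starChart a (q + s • E4.basisVector i)))
      (fderiv ℝ (fderiv ℝ Φ) (starChart a q) (starFrame a q i)) 0 :=
    hΦB.comp_hasDerivAt_of_eq (0 : ℝ) hcurve (by simp)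
  have hline : HasDerivAt (fun s : ℝ ↦ fderiv ℝ Φ (starChart a (q + s • E4.basisVector i))
      (starFrame a (q + s • E4.basisVector i) j))
      (fderiv ℝ (fderiv ℝ Φ) (starChart a q) (starFrame a q i) (starFrame a q j) +
        fderiv ℝ Φ (starChart a q) w) 0 := by
    have h := hc.clm_apply hw
    simpa using h
  -- the directional derivative of a differentiable function along the line is `fderiv · e_i`
  have hG : DifferentiableAt ℝ (fun q' ↦ fderiv ℝ Φ (starChart a q') (starFrame a q' j)) q := by
    have hd : DifferentiableAt ℝ (fun q' ↦ fderiv ℝ F q' (E4.basisVector j)) q :=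
      ((hF2.fderiv_right (m := 1) le_rfl).differentiableAt one_ne_zero).clm_apply
        (differentiableAt_const _)
    exact hd.congr_of_eventuallyEq heq.symm
  have hline' : HasDerivAt (fun s : ℝ ↦ (fun q' ↦ fderiv ℝ Φ (starChart a q') (starFrame a q' j))
      (q + s • E4.basisVector i))
      (fderiv ℝ (fun q' ↦ fderiv ℝ Φ (starChart a q') (starFrame a q' j)) q (E4.basisVector i)) 0 := by
    have h := hG.hasFDerivAt.comp_hasDerivAt_of_eq (0 : ℝ)
      (((hasDerivAt_id (0 : ℝ)).smul_const (E4.basisVector i)).const_add q) (by simp)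
    simp only [id, one_smul] at h
    exact h
  exact hline'.unique hline

end ChainRule

/-! ### Derivatives of the frame along the coordinate lines (the pairs entering the wave operator) -/

section FrameDerivatives

variable (a : ℝ) (q : E4)

/-- The frame vector `∂₀` is constant along every coordinate line. [folklore] -/
theorem hasDerivAt_starFrame_zero (i : Fin 4) :
    HasDerivAt (fun s : ℝ ↦ starFrame a (q + s • E4.basisVector i) 0) 0 0 := by
  simp only [starFrame_zero]
  exact hasDerivAt_const _ _

/-- `∂_{t*}` of `(0, n̂)` vanishes. [folklore] -/
theorem hasDerivAt_starFrame_one_line_zero :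
    HasDerivAt (fun s : ℝ ↦ starFrame a (q + s • E4.basisVector 0) 1) 0 0 := by
  simp only [starFrame_one, add_smul_basisVector_apply, show (2 : Fin 4) ≠ 0 by decide,
    show (3 : Fin 4) ≠ 0 by decide, if_false, add_zero]
  exact hasDerivAt_const _ _

/-- `∂_r` of `(0, n̂)` vanishes (the `r`-lines are straight). [folklore] -/
theorem hasDerivAt_starFrame_one_line_one :
    HasDerivAt (fun s : ℝ ↦ starFrame a (q + s • E4.basisVector 1) 1) 0 0 := by
  simp only [starFrame_one, add_smul_basisVector_apply, show (2 : Fin 4) ≠ 1 by decide,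
    show (3 : Fin 4) ≠ 1 by decide, if_false, add_zero]
  exact hasDerivAt_const _ _

/-- `∂_θ (0, r θ̂ + a cos θ φ̂) = −(0, r n̂ + a sin θ φ̂)` (`Kerr.hasDerivAt_kerrStar_theta_theta`).
[folklore] -/
theorem hasDerivAt_starFrame_two_line_two :
    HasDerivAt (fun s : ℝ ↦ starFrame a (q + s • E4.basisVector 2) 2)
      (E4.spaceEmbed (q 1 • -sphRadial (q 2) (q 3) + -(a * sin (q 2)) • sphAzimuth (q 3))) 0 := by
  simp only [starFrame_two, add_smul_basisVector_apply, show (1 : Fin 4) ≠ 2 by decide,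
    show (3 : Fin 4) ≠ 2 by decide, if_false, if_true, add_zero]
  have hin : HasDerivAt (fun s : ℝ ↦ q 1 • sphPolar (q 2 + s) (q 3) + (a * cos (q 2 + s)) • sphAzimuth (q 3))
      (q 1 • -sphRadial (q 2) (q 3) + -(a * sin (q 2)) • sphAzimuth (q 3)) 0 := by
    have h := HasDerivAt.comp_const_add (q 2) 0 (hasDerivAt_kerrStar_theta_theta a (q 1) (q 2 + 0) (q 3))
    simpa using h
  exact E4.spaceEmbed.hasFDerivAt.comp_hasDerivAt (0 : ℝ) hin

/-- `∂_φ (0, sin θ (r φ̂ + a ∂_φφ̂)) = (0, sin θ (r ∂_φφ̂ − a φ̂))` (`Kerr.hasDerivAt_kerrStar_phi_phi`).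
[folklore] -/
theorem hasDerivAt_starFrame_three_line_three :
    HasDerivAt (fun s : ℝ ↦ starFrame a (q + s • E4.basisVector 3) 3)
      (E4.spaceEmbed (sin (q 2) • (q 1 • sphHoriz (q 3) - a • sphAzimuth (q 3)))) 0 := by
  simp only [starFrame_three, add_smul_basisVector_apply, show (1 : Fin 4) ≠ 3 by decide,
    show (2 : Fin 4) ≠ 3 by decide, if_false, if_true, add_zero]
  have hin : HasDerivAt (fun s : ℝ ↦ sin (q 2) • (q 1 • sphAzimuth (q 3 + s) + a • sphHoriz (q 3 + s)))
      (sin (q 2) • (q 1 • sphHoriz (q 3) - a • sphAzimuth (q 3))) 0 := by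
    have h := HasDerivAt.comp_const_add (q 3) 0 (hasDerivAt_kerrStar_phi_phi a (q 1) (q 2) (q 3 + 0))
    simpa using h
  exact E4.spaceEmbed.hasFDerivAt.comp_hasDerivAt (0 : ℝ) hin

/-- `∂_r (0, sin θ (r φ̂ + a ∂_φφ̂)) = (0, sin θ φ̂)` (`Kerr.hasDerivAt_kerrStar_phi_r`). [folklore] -/
theorem hasDerivAt_starFrame_three_line_one :
    HasDerivAt (fun s : ℝ ↦ starFrame a (q + s • E4.basisVector 1) 3)
      (E4.spaceEmbed (sin (q 2) • sphAzimuth (q 3))) 0 := by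
  simp only [starFrame_three, add_smul_basisVector_apply, show (2 : Fin 4) ≠ 1 by decide,
    show (3 : Fin 4) ≠ 1 by decide, if_false, if_true, add_zero]
  have hin : HasDerivAt (fun s : ℝ ↦ sin (q 2) • ((q 1 + s) • sphAzimuth (q 3) + a • sphHoriz (q 3)))
      (sin (q 2) • sphAzimuth (q 3)) 0 := by
    have h := HasDerivAt.comp_const_add (q 1) 0 (hasDerivAt_kerrStar_phi_r a (q 1 + 0) (q 2) (q 3))
    simpa using h
  exact E4.spaceEmbed.hasFDerivAt.comp_hasDerivAt (0 : ℝ) hin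

end FrameDerivatives

/-! ### The Kerr–Schild geometry at the points of the chart -/

section Geometry

variable (M a : ℝ) {q : E4}

/-- `κ(q) = (0, Y_a) + t* ∂₀`. [folklore] -/
theorem starChart_eq_add_smul (a : ℝ) (q : E4) :
    starChart a q = E4.ofTimeSpace 0 (kerrStar a (q 1) (q 2) (q 3)) + (q 0) • E4.basisVector 0 := by
  rw [starChart, E4.ofTimeSpace_eq_smul_add', E4.ofTimeSpace_eq_smul_add', zero_smul, zero_add,
    add_comm]

/-- **`r ∘ κ = r`**: the Kerr–Schild radius of `κ(t*, r, θ, φ)` is `r` (`r > 0`). [cite: arXiv07060622, §4] -/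
theorem radius_starChart {q : E4} (hr : 0 < q 1) : radius a (starChart a q) = q 1 := by
  rw [starChart, radius_ofTimeSpace, radius_kerrStar a hr]

/-- The spatial part of `κ(q)` is `Y_a(r, θ, φ)`. [folklore] -/
theorem spatial_starChart (a : ℝ) (q : E4) :
    E4.spatial (starChart a q) = kerrStar a (q 1) (q 2) (q 3) := by
  rw [starChart, E4.spatial_ofTimeSpace]

/-- **`Σ ∘ κ = r² + a² cos² θ`**. [cite: ShlapentokhRothman2014KleinGordon, §1.2.1] -/
theorem blSigma_starChart {q : E4} (hr : 0 < q 1) :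
    blSigma a (E4.spatial (starChart a q)) = q 1 ^ 2 + a ^ 2 * cos (q 2) ^ 2 := by
  rw [spatial_starChart, blSigma_kerrStar a hr]

/-- **`H ∘ κ = Mr/(r² + a² cos² θ)`**. [cite: arXiv07060622, (33)] -/
theorem scalarH_starChart {q : E4} (hr : 0 < q 1) :
    scalarH M a (starChart a q) = M * q 1 / (q 1 ^ 2 + a ^ 2 * cos (q 2) ^ 2) := by
  rw [starChart_eq_add_smul, scalarH_add_smul_basisVector_zero, scalarH_kerrStar M a hr]

/-- Components of the coordinate basis vectors. [folklore] -/
private theorem basisVector_apply (μ ν : Fin 4) : E4.basisVector μ ν = if ν = μ then 1 else 0 :=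
  PiLp.single_apply _ _ _ _ _

/-- **`ℓ♯ ∘ κ = (0, n̂) − ∂₀ = κ_*(∂_r − ∂_{t*})`**: along the chart the Kerr–Schild null vector is the
difference of the `r`- and `t*`-frame vectors (`Kerr.nullSpatial_kerrStar`; its `t*`-component is
`−1`), i.e. `ℓ♯ = ∂_r` of the system `(v, r, θ, φ*)`, `v = t* + r` (Aretakis's `Y`).
[cite: arXiv07060622, (34) and §4] -/
theorem nullVector_starChart {q : E4} (hr : 0 < q 1) :
    nullVector a (starChart a q) = starFrame a q 1 - E4.basisVector 0 := by
  have hr' : 0 < radius a (E4.ofTimeSpace 0 (kerrStar a (q 1) (q 2) (q 3))) := by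
    rwa [radius_kerrStar a hr]
  have hsp := nullSpatial_kerrStar a hr (q 2) (q 3)
  ext μ
  refine Fin.cases ?_ (fun i ↦ ?_) μ
  · rw [nullVector_apply]
    simp [starFrame_one, nullCovectorFun_apply_zero]
  · have h1 : nullVector a (starChart a q) i.succ = nullCovectorFun a (starChart a q) i.succ := by
      rw [nullVector_apply]; simp [Fin.succ_ne_zero]
    have h2 : nullCovectorFun a (starChart a q) i.succ =
        nullCovectorFun a (E4.ofTimeSpace 0 (kerrStar a (q 1) (q 2) (q 3))) i.succ := by
      rw [starChart_eq_add_smul, nullCovectorFun_add_smul_basisVector_zero]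
    have h3 := congrArg (fun v : E3 ↦ v i) hsp
    simp only [nullSpatial_apply] at h3
    rw [h1, h2, h3]
    simp [starFrame_one, Fin.succ_ne_zero]

end Geometry

/-! ### The coordinate wave operator `∑ g^{μν} ∂_μ∂_ν + ∑ c^ν ∂_ν` in the frame of the chart -/

section FrameForm

/-- Expansion of a bilinear form in the coordinate basis: `B(u, v) = ∑ u^μ v^ν B(∂_μ, ∂_ν)`
(the same statement as `bilin_eq_sum_sum` of the barrier file
`ExtremalHorizonChargeConservationProofs.lean`, which this geometry file must not import; kept
private). [folklore] -/
private theorem bilin_apply_eq_sum_sum (B : E4 →L[ℝ] E4 →L[ℝ] ℝ) (u v : E4) :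
    B u v = ∑ μ, ∑ ν, u μ * v ν * B (E4.basisVector μ) (E4.basisVector ν) := by
  conv_lhs => rw [eq_sum_basisVector u, map_sum]
  rw [FunLike.coe_sum, Finset.sum_apply]
  refine Finset.sum_congr rfl fun μ _ ↦ ?_
  rw [map_smul, FunLike.coe_smul, Pi.smul_apply, smul_eq_mul]
  conv_lhs => rw [eq_sum_basisVector v, map_sum]
  rw [Finset.mul_sum]
  refine Finset.sum_congr rfl fun ν _ ↦ ?_
  rw [map_smul, smul_eq_mul]
  ring

/-- **The contraction `∑ g^{μν} B(∂_μ, ∂_ν)` of the inverse Kerr–Schild metric with a bilinear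
form**: `= −B(∂₀, ∂₀) + ∑_{i=1}^3 B(∂_i, ∂_i) − 2H B(ℓ♯, ℓ♯)` (`g^{μν} = η^{μν} − 2H ℓ^μ ℓ^ν`).
[cite: KerrSchild1965, §2] -/
theorem sum_inverseMetric_mul_bilinForm (M a : ℝ) (x : E4) (B : E4 →L[ℝ] E4 →L[ℝ] ℝ) :
    ∑ μ, ∑ ν, inverseMetric M a x μ ν * B (E4.basisVector μ) (E4.basisVector ν) =
      -B (E4.basisVector 0) (E4.basisVector 0) +
          ∑ i : Fin 3, B (E4.basisVector i.succ) (E4.basisVector i.succ) -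
        2 * scalarH M a x * B (nullVector a x) (nullVector a x) := by
  rw [bilin_apply_eq_sum_sum B (nullVector a x) (nullVector a x)]
  simp only [inverseMetric_apply, Fin.sum_univ_four, Fin.sum_univ_three, Fin.isValue, ↓reduceIte,
    Fin.reduceEq, show (Fin.succ 0 : Fin 4) = 1 from rfl, show (Fin.succ 1 : Fin 4) = 2 from rfl,
    show (Fin.succ 2 : Fin 4) = 3 from rfl]
  ring

/-- **The first-order part**: `∑ c^ν L(∂_ν) = −(2M/Σ) L(ℓ♯)` (`Kerr.divInverseMetric_eq`), `r > 0`.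
[cite: KerrSchild1965, §2] -/
theorem sum_divInverseMetric_mul (M a : ℝ) {x : E4} (hx : 0 < radius a x) (L : E4 →L[ℝ] ℝ) :
    ∑ ν, divInverseMetric M a x ν * L (E4.basisVector ν) =
      -(2 * M / blSigma a (E4.spatial x)) * L (nullVector a x) := by
  simp only [divInverseMetric_eq M a hx, mul_assoc, ← Finset.mul_sum]
  congr 1
  rw [← sum_apply_basisVector_mul_nullVector L a x]
  exact Finset.sum_congr rfl fun ν _ ↦ mul_comm _ _

/-- `(0, e_i) = ∂_{i+1}`. [folklore] -/
theorem spaceEmbed_e (i : Fin 3) : E4.spaceEmbed (E3.e i) = E4.basisVector i.succ := by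
  ext j
  refine Fin.cases ?_ (fun k ↦ ?_) j
  · simp [Fin.succ_ne_zero]
  · rw [E4.spaceEmbed_apply, E4.ofTimeSpace_apply_succ]
    simp [E3.e, Fin.succ_inj]

/-- **The flat spatial trace in the spheroidal frame** (E4 form of `Kerr.frame_bilinear_identity`
with `Kerr.sph_frame_trace`): for every bilinear `B` and all `r, a, θ, φ`, with
`ñ = (0, n̂)`, `Θ̃ = (0, r θ̂ + a cos θ φ̂)`, `P̃ = (0, r φ̂ + a ∂_φφ̂)`,
`(r² + a² cos² θ) ∑_{i=1}^3 B(∂_i, ∂_i) = (r² + a²) B(ñ, ñ) + B(Θ̃, Θ̃) + B(P̃, P̃) + a sin θ (B(ñ, P̃) + B(P̃, ñ))`.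
[cite: arXiv07060622, §4] -/
theorem spatial_trace_spheroidal (B : E4 →L[ℝ] E4 →L[ℝ] ℝ) (a r θ φ : ℝ) :
    (r ^ 2 + a ^ 2 * cos θ ^ 2) * ∑ i : Fin 3, B (E4.basisVector i.succ) (E4.basisVector i.succ) =
      (r ^ 2 + a ^ 2) * B (E4.spaceEmbed (sphRadial θ φ)) (E4.spaceEmbed (sphRadial θ φ)) +
        B (E4.spaceEmbed (r • sphPolar θ φ + (a * cos θ) • sphAzimuth φ))
          (E4.spaceEmbed (r • sphPolar θ φ + (a * cos θ) • sphAzimuth φ)) +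
        B (E4.spaceEmbed (r • sphAzimuth φ + a • sphHoriz φ))
          (E4.spaceEmbed (r • sphAzimuth φ + a • sphHoriz φ)) +
        a * sin θ * (B (E4.spaceEmbed (sphRadial θ φ)) (E4.spaceEmbed (r • sphAzimuth φ + a • sphHoriz φ)) +
          B (E4.spaceEmbed (r • sphAzimuth φ + a • sphHoriz φ)) (E4.spaceEmbed (sphRadial θ φ))) := by
  -- the bilinear form on `E3`
  set B' : E3 →L[ℝ] E3 →L[ℝ] ℝ := B.bilinearComp E4.spaceEmbed E4.spaceEmbed with hB'
  have happ : ∀ u v : E3, B' u v = B (E4.spaceEmbed u) (E4.spaceEmbed v) := fun u v ↦ rfl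
  -- the coordinate trace
  have htr : ∑ i : Fin 3, B (E4.basisVector i.succ) (E4.basisVector i.succ) =
      ∑ i : Fin 3, B' (E3.e i) (E3.e i) :=
    Finset.sum_congr rfl fun i _ ↦ by rw [happ, spaceEmbed_e]
  rw [htr, ← sph_frame_trace B' θ φ]
  -- the algebraic frame identity, for the linear-map version of `B'`
  set B'' : E3 →ₗ[ℝ] E3 →ₗ[ℝ] ℝ := LinearMap.mk₂ ℝ (fun u v ↦ B' u v)
    (fun u₁ u₂ v ↦ by rw [map_add]; rfl)
    (fun c u v ↦ by simp only [map_smul, FunLike.coe_smul, Pi.smul_apply])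
    (fun u v₁ v₂ ↦ by simp only [map_add]) (fun c u v ↦ by simp only [map_smul]) with hB''
  have happ'' : ∀ u v : E3, B'' u v = B' u v := fun u v ↦ rfl
  have key := frame_bilinear_identity B'' (sphRadial θ φ) (sphPolar θ φ) (sphAzimuth φ) a r θ
  simp only [happ'', smul_eq_mul] at key
  have hP : r • sphAzimuth φ - a • (sin θ • sphRadial θ φ + cos θ • sphPolar θ φ) =
      r • sphAzimuth φ + a • sphHoriz φ := by
    rw [sphHoriz_eq θ φ, smul_neg, sub_eq_add_neg]
  rw [hP] at key
  simp only [happ] at key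
  simp only [happ]
  linarith [key]

/-- **The Kerr–Schild coordinate wave operator in the frame of the Kerr-star chart.** At the
point `x = κ(t*, r, θ, φ)` with `r > 0`, for every bilinear `B` and linear `L` (to be the Hessian
and the differential of a function at `x`):
`Σ · (∑ g^{μν}(x) B(∂_μ, ∂_ν) + ∑ c^ν(x) L(∂_ν))
  = −Σ B(∂₀, ∂₀) + (r² + a²) B(ñ, ñ) + B(Θ̃, Θ̃) + B(P̃, P̃) + a sin θ (B(ñ, P̃) + B(P̃, ñ))
    − 2Mr B(ℓ♯, ℓ♯) − 2M L(ℓ♯)`,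
`Σ = r² + a² cos² θ`, `ℓ♯ = ñ − ∂₀` (`nullVector_starChart`). With `B = D²Φ(x)`, `L = DΦ(x)` the
left side is `Σ □_g Φ(x)` in Kerr–Schild coordinates (`□_g = ∑ g^{μν}∂_μ∂_ν + ∑ c^ν ∂_ν`,
`Kerr.dalembertian_eq_divergence`, `Kerr.divInverseMetric_eq`); this is `ρ² □_g` of Aretakis,
JFA 263 (2012), §2.4 / ATMP 19 (2015), §5.2, written with Hessians along the frame instead of
iterated coordinate derivatives (cf. `coordWave_starChart`). Valid at every `θ`, poles included.
[cite: Aretakis2012, §2.4] -/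
theorem blSigma_mul_coordWave_frame (M a : ℝ) {q : E4} (hr : 0 < q 1) (B : E4 →L[ℝ] E4 →L[ℝ] ℝ)
    (L : E4 →L[ℝ] ℝ) :
    (q 1 ^ 2 + a ^ 2 * cos (q 2) ^ 2) *
        (∑ μ, ∑ ν, inverseMetric M a (starChart a q) μ ν * B (E4.basisVector μ) (E4.basisVector ν) +
          ∑ ν, divInverseMetric M a (starChart a q) ν * L (E4.basisVector ν)) =
      -(q 1 ^ 2 + a ^ 2 * cos (q 2) ^ 2) * B (E4.basisVector 0) (E4.basisVector 0) +
        ((q 1 ^ 2 + a ^ 2) * B (starFrame a q 1) (starFrame a q 1) +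
          B (starFrame a q 2) (starFrame a q 2) +
          B (E4.spaceEmbed (q 1 • sphAzimuth (q 3) + a • sphHoriz (q 3)))
            (E4.spaceEmbed (q 1 • sphAzimuth (q 3) + a • sphHoriz (q 3))) +
          a * sin (q 2) * (B (starFrame a q 1) (E4.spaceEmbed (q 1 • sphAzimuth (q 3) + a • sphHoriz (q 3))) +
            B (E4.spaceEmbed (q 1 • sphAzimuth (q 3) + a • sphHoriz (q 3))) (starFrame a q 1))) -
        2 * M * q 1 * B (nullVector a (starChart a q)) (nullVector a (starChart a q)) -
        2 * M * L (nullVector a (starChart a q)) := by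
  have hx : 0 < radius a (starChart a q) := by rw [radius_starChart a hr]; exact hr
  have hS := blSigma_starChart a hr (q := q)
  have hSpos : 0 < q 1 ^ 2 + a ^ 2 * cos (q 2) ^ 2 := by positivity
  have hH := scalarH_starChart M a hr (q := q)
  rw [sum_inverseMetric_mul_bilinForm, sum_divInverseMetric_mul M a hx, hS, hH, mul_add]
  have h1 : (q 1 ^ 2 + a ^ 2 * cos (q 2) ^ 2) * (-B (E4.basisVector 0) (E4.basisVector 0) +
        ∑ i : Fin 3, B (E4.basisVector i.succ) (E4.basisVector i.succ) -
        2 * (M * q 1 / (q 1 ^ 2 + a ^ 2 * cos (q 2) ^ 2)) *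
          B (nullVector a (starChart a q)) (nullVector a (starChart a q))) =
      -(q 1 ^ 2 + a ^ 2 * cos (q 2) ^ 2) * B (E4.basisVector 0) (E4.basisVector 0) +
        (q 1 ^ 2 + a ^ 2 * cos (q 2) ^ 2) * ∑ i : Fin 3, B (E4.basisVector i.succ) (E4.basisVector i.succ) -
        2 * M * q 1 * B (nullVector a (starChart a q)) (nullVector a (starChart a q)) := by
    field_simp
  have h2 : (q 1 ^ 2 + a ^ 2 * cos (q 2) ^ 2) * (-(2 * M / (q 1 ^ 2 + a ^ 2 * cos (q 2) ^ 2)) *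
      L (nullVector a (starChart a q))) = -(2 * M * L (nullVector a (starChart a q))) := by
    field_simp
  rw [h1, h2, spatial_trace_spheroidal B a (q 1) (q 2) (q 3)]
  simp only [starFrame_one, starFrame_two]
  ring

end FrameForm

/-! ### The wave operator in the coordinates `(t*, r, θ, φ*)` -/

section CoordinateForm

/-- **The pull-back of a function to the Kerr-star coordinates**: `F = Φ ∘ κ`,
`F(t*, r, θ, φ) = Φ(t*, Y_a(r, θ, φ))`. [cite: arXiv07060622, §4] -/
def starPull (a : ℝ) (Φ : E4 → ℝ) : E4 → ℝ := fun q ↦ Φ (starChart a q)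

/-- Unfolding lemma. [folklore] -/
theorem starPull_apply (a : ℝ) (Φ : E4 → ℝ) (q : E4) : starPull a Φ q = Φ (starChart a q) := rfl

variable {M a : ℝ} {Φ : E4 → ℝ} {q : E4}

/-- First coordinate derivatives of the pull-back: `∂_i F(q) = DΦ(κ q)(starFrame a q i)`. [folklore] -/
theorem fderiv_starPull (hΦ : DifferentiableAt ℝ Φ (starChart a q)) (i : Fin 4) :
    fderiv ℝ (starPull a Φ) q (E4.basisVector i) = fderiv ℝ Φ (starChart a q) (starFrame a q i) :=
  fderiv_comp_starChart hΦ i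

/-- Second coordinate derivatives of the pull-back along the pairs of coordinate lines entering the
wave operator: `∂₀∂₀F, ∂₁∂₀F, ∂₁∂₁F` carry no first-order term (the `t*`- and `r`-lines are straight
and the frame is constant along them), `∂₂∂₂F, ∂₃∂₃F, ∂₁∂₃F` carry the derivatives of the frame.
[folklore] -/
theorem fderiv_fderiv_starPull (hΦ : ContDiffAt ℝ 2 Φ (starChart a q)) :
    (fderiv ℝ (fderiv ℝ (starPull a Φ)) q (E4.basisVector 0) (E4.basisVector 0) =
      fderiv ℝ (fderiv ℝ Φ) (starChart a q) (E4.basisVector 0) (E4.basisVector 0)) ∧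
    (fderiv ℝ (fderiv ℝ (starPull a Φ)) q (E4.basisVector 1) (E4.basisVector 0) =
      fderiv ℝ (fderiv ℝ Φ) (starChart a q) (starFrame a q 1) (E4.basisVector 0)) ∧
    (fderiv ℝ (fderiv ℝ (starPull a Φ)) q (E4.basisVector 1) (E4.basisVector 1) =
      fderiv ℝ (fderiv ℝ Φ) (starChart a q) (starFrame a q 1) (starFrame a q 1)) ∧
    (fderiv ℝ (fderiv ℝ (starPull a Φ)) q (E4.basisVector 2) (E4.basisVector 2) =
      fderiv ℝ (fderiv ℝ Φ) (starChart a q) (starFrame a q 2) (starFrame a q 2) +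
        fderiv ℝ Φ (starChart a q)
          (E4.spaceEmbed (q 1 • -sphRadial (q 2) (q 3) + -(a * sin (q 2)) • sphAzimuth (q 3)))) ∧
    (fderiv ℝ (fderiv ℝ (starPull a Φ)) q (E4.basisVector 3) (E4.basisVector 3) =
      fderiv ℝ (fderiv ℝ Φ) (starChart a q) (starFrame a q 3) (starFrame a q 3) +
        fderiv ℝ Φ (starChart a q) (E4.spaceEmbed (sin (q 2) • (q 1 • sphHoriz (q 3) - a • sphAzimuth (q 3))))) ∧
    (fderiv ℝ (fderiv ℝ (starPull a Φ)) q (E4.basisVector 1) (E4.basisVector 3) =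
      fderiv ℝ (fderiv ℝ Φ) (starChart a q) (starFrame a q 1) (starFrame a q 3) +
        fderiv ℝ Φ (starChart a q) (E4.spaceEmbed (sin (q 2) • sphAzimuth (q 3)))) := by
  refine ⟨?_, ?_, ?_, ?_, ?_, ?_⟩
  · have h := fderiv_fderiv_comp_starChart hΦ 0 0 (hasDerivAt_starFrame_zero a q 0)
    rw [map_zero, add_zero] at h
    exact h
  · have h := fderiv_fderiv_comp_starChart hΦ 1 0 (hasDerivAt_starFrame_zero a q 1)
    rw [map_zero, add_zero] at h
    exact h
  · have h := fderiv_fderiv_comp_starChart hΦ 1 1 (hasDerivAt_starFrame_one_line_one a q)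
    rw [map_zero, add_zero] at h
    exact h
  · exact fderiv_fderiv_comp_starChart hΦ 2 2 (hasDerivAt_starFrame_two_line_two a q)
  · exact fderiv_fderiv_comp_starChart hΦ 3 3 (hasDerivAt_starFrame_three_line_three a q)
  · exact fderiv_fderiv_comp_starChart hΦ 1 3 (hasDerivAt_starFrame_three_line_one a q)

/-- The first-order vector identity of `Kerr.frame_vector_identity`, multiplied by `sin² θ` (no
inverses): with `h = −(sin θ n + cos θ t)`,
`sin² θ (2r n + (−r n − a sin θ p) + 2a sin θ p) + sin θ cos θ (r t + a cos θ p) + sin θ (r h − a p) = 0`.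
[folklore] -/
theorem frame_vector_identity_sin_sq (n t p : E3) (a r θ : ℝ) :
    (sin θ ^ 2) • ((2 * r) • n + (r • -n + -(a * sin θ) • p) + (2 * a * sin θ) • p) +
        (sin θ * cos θ) • (r • t + (a * cos θ) • p) +
        sin θ • (r • -(sin θ • n + cos θ • t) - a • p) = 0 := by
  have h := sin_sq_add_cos_sq θ
  calc (sin θ ^ 2) • ((2 * r) • n + (r • -n + -(a * sin θ) • p) + (2 * a * sin θ) • p) +
        (sin θ * cos θ) • (r • t + (a * cos θ) • p) + sin θ • (r • -(sin θ • n + cos θ • t) - a • p)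
      = (a * sin θ * (sin θ ^ 2 + cos θ ^ 2 - 1)) • p := by module
    _ = 0 := by rw [h, sub_self, mul_zero, zero_smul]

/-- **The Kerr wave operator in the coordinates `(t*, r, θ, φ*)` (Kerr–Schild time and Kerr's
ingoing spheroidal coordinates).** Let `Φ` be `C²` at `x = κ(q)`, `q = (t*, r, θ, φ)` with `r > 0` and
`sin θ ≠ 0`, and `F = Φ ∘ κ` (`starPull`). Then, with `Σ = r² + a² cos² θ` and
`∂_i∂_j F = D²F(q)(∂_i, ∂_j)`,
`Σ · (∑ g^{μν}(x) ∂_μ∂_νΦ(x) + ∑ c^ν(x) ∂_νΦ(x))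
   = −Σ ∂₀∂₀F + (r² + a²) ∂₁∂₁F + 2r ∂₁F + ∂₂∂₂F + (cos θ/sin θ) ∂₂F + (sin θ)⁻² ∂₃∂₃F + 2a ∂₁∂₃F
     − 2Mr (∂₁∂₁F − 2 ∂₁∂₀F + ∂₀∂₀F) − 2M (∂₁F − ∂₀F)`.
The left side is `Σ □_g Φ(x)` for the Kerr metric in Kerr–Schild coordinates
(`Kerr.dalembertian_eq_divergence`: `□_g = ∑ ∂_μ g^{μν} ∂_ν = ∑ g^{μν}∂_μ∂_ν + ∑ c^ν∂_ν`, `det g = −1`).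
In terms of `T = ∂_{t*} = ∂₀`, the Kerr–Schild radial derivative `∂_ρ = ∂₁` and `Y = ℓ♯ = ∂₁ − ∂₀`
this is `ρ²□_g ψ = Δ YYψ + 2(r² + a²) TYψ + 2a YΦψ + (Δ' ) Yψ + 2r Tψ + Δ̸_{(θ,φ*)}ψ + a² sin² θ TTψ + 2a TΦψ`
regrouped, i.e. the operator `ρ² □_g` of Aretakis, JFA 263 (2012), §2.4 (the system
`(v, r, θ, φ*)`, `v = t* + r`) and ATMP 19 (2015), §5.2, whose restriction to `r = M = a` is
`horizon_density_deriv_identity` of `ExtremalHorizonChargeConservationProofs.lean`. The `M = 0` case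
is `Kerr.laplacian_kerrStar`. Proof: `blSigma_mul_coordWave_frame` with `B = D²Φ(x)`, `L = DΦ(x)`,
the chain rules `fderiv_fderiv_starPull`, symmetry of `D²Φ(x)`, and `Kerr.frame_vector_identity` for
the first-order terms. [cite: Aretakis2012, §2.4] -/
theorem blSigma_mul_coordWave_starChart (M : ℝ) (hr : 0 < q 1) (hθ : sin (q 2) ≠ 0)
    (hΦ : ContDiffAt ℝ 2 Φ (starChart a q)) :
    (q 1 ^ 2 + a ^ 2 * cos (q 2) ^ 2) *
        (∑ μ, ∑ ν, inverseMetric M a (starChart a q) μ ν *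
            fderiv ℝ (fderiv ℝ Φ) (starChart a q) (E4.basisVector μ) (E4.basisVector ν) +
          ∑ ν, divInverseMetric M a (starChart a q) ν * fderiv ℝ Φ (starChart a q) (E4.basisVector ν)) =
      -(q 1 ^ 2 + a ^ 2 * cos (q 2) ^ 2) *
          fderiv ℝ (fderiv ℝ (starPull a Φ)) q (E4.basisVector 0) (E4.basisVector 0) +
        (q 1 ^ 2 + a ^ 2) * fderiv ℝ (fderiv ℝ (starPull a Φ)) q (E4.basisVector 1) (E4.basisVector 1) +
        2 * q 1 * fderiv ℝ (starPull a Φ) q (E4.basisVector 1) +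
        fderiv ℝ (fderiv ℝ (starPull a Φ)) q (E4.basisVector 2) (E4.basisVector 2) +
        cos (q 2) / sin (q 2) * fderiv ℝ (starPull a Φ) q (E4.basisVector 2) +
        (sin (q 2) ^ 2)⁻¹ * fderiv ℝ (fderiv ℝ (starPull a Φ)) q (E4.basisVector 3) (E4.basisVector 3) +
        2 * a * fderiv ℝ (fderiv ℝ (starPull a Φ)) q (E4.basisVector 1) (E4.basisVector 3) -
        2 * M * q 1 * (fderiv ℝ (fderiv ℝ (starPull a Φ)) q (E4.basisVector 1) (E4.basisVector 1) -
          2 * fderiv ℝ (fderiv ℝ (starPull a Φ)) q (E4.basisVector 1) (E4.basisVector 0) +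
          fderiv ℝ (fderiv ℝ (starPull a Φ)) q (E4.basisVector 0) (E4.basisVector 0)) -
        2 * M * (fderiv ℝ (starPull a Φ) q (E4.basisVector 1) - fderiv ℝ (starPull a Φ) q (E4.basisVector 0)) := by
  have hΦd : DifferentiableAt ℝ Φ (starChart a q) := hΦ.differentiableAt two_ne_zero
  have hsymm : ∀ u v, fderiv ℝ (fderiv ℝ Φ) (starChart a q) u v =
      fderiv ℝ (fderiv ℝ Φ) (starChart a q) v u := fun u v ↦ (hΦ.isSymmSndFDerivAt (by simp)).eq u v
  obtain ⟨h00, h10, h11, h22, h33, h13⟩ := fderiv_fderiv_starPull hΦ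
  rw [blSigma_mul_coordWave_frame M a hr (fderiv ℝ (fderiv ℝ Φ) (starChart a q))
    (fderiv ℝ Φ (starChart a q)), h00, h10, h11, h22, h33, h13, fderiv_starPull hΦd 0,
    fderiv_starPull hΦd 1, fderiv_starPull hΦd 2, nullVector_starChart a hr]
  have hh : sphHoriz (q 3) = -(sin (q 2) • sphRadial (q 2) (q 3) + cos (q 2) • sphPolar (q 2) (q 3)) :=
    sphHoriz_eq (q 2) (q 3)
  simp only [starFrame_zero, starFrame_one, starFrame_two, starFrame_three]
  rw [hh]
  -- expand the Hessian and the differential by (bi)linearity, and order the symmetric pairs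
  simp only [map_add, map_sub, map_neg, map_smul, smul_eq_mul, FunLike.coe_add,
    FunLike.coe_sub, FunLike.coe_neg, Pi.add_apply, Pi.sub_apply,
    Pi.neg_apply, FunLike.coe_smul, Pi.smul_apply,
    smul_add, smul_neg, smul_sub, neg_add, hsymm (E4.basisVector 0),
    hsymm (E4.spaceEmbed (sphAzimuth (q 3))) (E4.spaceEmbed (sphRadial (q 2) (q 3))),
    hsymm (E4.spaceEmbed (sphPolar (q 2) (q 3))) (E4.spaceEmbed (sphRadial (q 2) (q 3))),
    hsymm (E4.spaceEmbed (sphAzimuth (q 3))) (E4.spaceEmbed (sphPolar (q 2) (q 3)))]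
  -- the first-order identity (inverse-free form)
  have key := congrArg (fun v ↦ fderiv ℝ Φ (starChart a q) (E4.spaceEmbed v))
    (frame_vector_identity_sin_sq (sphRadial (q 2) (q 3)) (sphPolar (q 2) (q 3)) (sphAzimuth (q 3))
      a (q 1) (q 2))
  simp only [map_add, map_sub, map_neg, map_smul, smul_eq_mul, map_zero, smul_add, smul_neg,
    neg_add] at key
  have hsc := sin_sq_add_cos_sq (q 2)
  field_simp
  linear_combination key +
    (a * fderiv ℝ Φ (starChart a q) (E4.spaceEmbed (sphAzimuth (q 3))) * (-sin (q 2) - 1)) * hsc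

end CoordinateForm

/-! ### The chart and the time translations -/

section TimeTranslation

/-- The `t*`-component of `κ(q)` is `q⁰`. [cite: arXiv07060622, §4] -/
@[simp] theorem starChart_apply_zero (a : ℝ) (q : E4) : starChart a q 0 = q 0 := rfl

/-- **The chart commutes with the time translations**: `κ(q + s ∂₀) = κ(q) + s ∂_{t*}` — the
coordinate `t*` of `(t*, r, θ, φ*)` is the Kerr–Schild time itself, so that the stationary Killing
field `T = ∂_{t*}` of the chart is `∂₀` in these coordinates and `T`-derivatives of `Φ` are
`∂₀`-derivatives of `Φ ∘ κ` at all orders (Aretakis, JFA 263 (2012), §2.4: `T = ∂_{t*}`).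
[cite: Aretakis2012, §2.4] -/
theorem starChart_add_smul_basisVector_zero (a : ℝ) (q : E4) (s : ℝ) :
    starChart a (q + s • E4.basisVector 0) = starChart a q + s • E4.basisVector 0 := by
  have h0 : (q + s • E4.basisVector 0) 0 = q 0 + s := by
    rw [add_smul_basisVector_apply, if_pos rfl]
  have h1 : (q + s • E4.basisVector 0) 1 = q 1 := by
    rw [add_smul_basisVector_apply, if_neg (by decide), add_zero]
  have h2 : (q + s • E4.basisVector 0) 2 = q 2 := by
    rw [add_smul_basisVector_apply, if_neg (by decide), add_zero]
  have h3 : (q + s • E4.basisVector 0) 3 = q 3 := by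
    rw [add_smul_basisVector_apply, if_neg (by decide), add_zero]
  rw [starChart_eq_add_smul, starChart_eq_add_smul, h0, h1, h2, h3, add_smul, add_assoc]

/-- Hence `(Φ ∘ κ)(q + s ∂₀) = Φ(κ(q) + s ∂_{t*})`: the pull-back intertwines the time
translations. [cite: Aretakis2012, §2.4] -/
theorem starPull_add_smul_basisVector_zero (a : ℝ) (Φ : E4 → ℝ) (q : E4) (s : ℝ) :
    starPull a Φ (q + s • E4.basisVector 0) = Φ (starChart a q + s • E4.basisVector 0) := by
  rw [starPull_apply, starChart_add_smul_basisVector_zero]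

end TimeTranslation

end Kerr

end Literature.Geometry.Lorentzian

end
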